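import Mathlib
import Summits.Ventures.LatticeQCDFlow.Scaling.GroupCrossCutFloorAllT
import Summits.Ventures.LatticeQCDFlow.Scaling.SUNOneLink

/-!
# LatticeQCDFlow / Scaling — (LC) AT EVERY SEPARATION and (U′) AT STRONG COUPLING FOR EVERY `R`
# FOR `SU(N)` LATTICE GAUGE THEORY, `N ≥ 2`, in the fundamental representation

HONEST FRAMING: exact (Metropolis-corrected) sampling algorithms for lattice gauge theory;
figures of merit are autocorrelation/cost numbers at stated couplings and volumes; no
continuum-physics claim.

Venture `LatticeQCDFlow` (cell pub-lqcd), topic `Scaling`, FANOUT row 30 (lean-1) — OUR WORK, file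
10 (the instance) of the extension of the slab-chain proof of (LC)/(U′) to non-abelian gauge
groups.  `Scaling/GroupCrossCutFloorAllT.lean` proved (LC)/(U′) for every compact gauge group with
one-link data `OneLink ρ θ`, with leading tube coefficient `N θ^{4t+1}`;
`Scaling/SUNOneLink.lean` supplied the data for `G = SU(N)`, `ρ = fundamentalRep (Fin N)`:
`θ = m₂(N)/N`, `= 1/(2N)` for `N ≥ 3`, `= 1/2` for `N = 2`.  Hence, with NO physics input:
* **`crossCutCorrelatorFloor_sun`**, **`crossCutCorrelatorFloorR_sun`** — for `N ≥ 2`, every `d`,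
  `i < j`, `a ∉ {i, j}` and EVERY `R` there is ONE `β₀ > 0` such that
  `Conjectures.CrossCutCorrelatorFloor d N SU(N) (fundamentalRep (Fin N)) β R i j a` (and the
  repaired `…FloorR`) holds for every real `β ≠ 0` with `|β| ≤ β₀`: hypothesis (U′) of the volume
  law (`Barriers.VolumeScalingOfTraining` via `Theory2.defectFromCorrelation`) AT STRONG COUPLING
  for `SU(2)` (the cell's rung R1a) and `SU(3)` (rung R1), every separation, uniformly in the volume;
* **`torusTruncC_leadingCoeff_sun`** — (LC) for `SU(N)`, `N ≥ 3`: the truncated torus correlator of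
  two parallel plaquettes `Re tr U_p` stacked `t ≥ 1` units apart is
  `2^{-(4t+1)} N^{-4t} β^{4t} + O(β^{4t+1})` on every torus of side `≥ max 3 (2t) + 1` — the printed
  leading tube of the strong-coupling expansion [cite: MontvayMunster1994, §3.6.2 (3.437)];
  **`torusTruncC_leadingCoeff_su2`** — for `SU(2)`: `2^{-4t} β^{4t} + O(β^{4t+1})`.
What is NOT claimed: intermediate `β`; other representations; `U(N)`.  Elementary given the
imports; nothing is cited as a fact; no `def`, no `sorry`.
-/

noncomputable section

open MeasureTheory Filter Topology Asymptotics Finset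
open Literature.MathematicalPhysics.QuantumFieldTheory
open Literature.MathematicalPhysics.QuantumLattice (plaquetteObs fundamentalRep)

namespace Summit.Ventures.LatticeQCDFlow.Theory2.GroupLayer

variable {d N : ℕ} {a i j : Fin d}

/-- `SU(N)` is second countable (a subspace of `M_N(ℂ)`), recorded locally. [folklore] -/
theorem secondCountableTopology_SU (N : ℕ) :
    SecondCountableTopology (Matrix.specialUnitaryGroup (Fin N) ℂ) :=
  haveI : SecondCountableTopology (Matrix (Fin N) (Fin N) ℂ) :=
    inferInstanceAs (SecondCountableTopology (Fin N → Fin N → ℂ))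
  Topology.IsEmbedding.subtypeVal.secondCountableTopology

/-- **(U′) AT STRONG COUPLING FOR `SU(N)`, `N ≥ 2`, EVERY `R`.**  For `d`-dimensional `SU(N)`
lattice gauge theory in the fundamental representation (`i < j`, `a ∉ {i, j}`) and every `R`: there
is `β₀ > 0` such that for every real `β ≠ 0` with `|β| ≤ β₀` the venture's cross-cut correlator
floor `Conjectures.CrossCutCorrelatorFloor d N SU(N) (fundamentalRep (Fin N)) β R i j a` holds (all
torus sides `≥ max 3 (2(2R+1)) + 1`, all sites). [folklore] -/
theorem crossCutCorrelatorFloor_sun (hN : 2 ≤ N) (hij : i < j) (hai : a ≠ i) (haj : a ≠ j) (R : ℕ) :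
    ∃ β₀ : ℝ, 0 < β₀ ∧ ∀ β : ℝ, β ≠ 0 → |β| ≤ β₀ →
      Conjectures.CrossCutCorrelatorFloor d N (Matrix.specialUnitaryGroup (Fin N) ℂ)
        (fundamentalRep (Fin N)) β R i j a := by
  haveI := secondCountableTopology_SU N
  haveI : NeZero N := ⟨by omega⟩
  exact crossCutCorrelatorFloor_of_oneLink (oneLink_fundamentalRep hN) hij hai haj R

/-- **The repaired item (U′-R) at strong coupling for `SU(N)`, `N ≥ 2`, every `R`.** [folklore] -/
theorem crossCutCorrelatorFloorR_sun (hN : 2 ≤ N) (hij : i < j) (hai : a ≠ i) (haj : a ≠ j) (R : ℕ) :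
    ∃ β₀ : ℝ, 0 < β₀ ∧ ∀ β : ℝ, β ≠ 0 → |β| ≤ β₀ →
      Conjectures.CrossCutCorrelatorFloorR d N (Matrix.specialUnitaryGroup (Fin N) ℂ)
        (fundamentalRep (Fin N)) β R i j a := by
  haveI := secondCountableTopology_SU N
  haveI : NeZero N := ⟨by omega⟩
  exact crossCutCorrelatorFloorR_of_oneLink (oneLink_fundamentalRep hN) hij hai haj R

/-- **(LC) AT EVERY SEPARATION FOR `SU(N)`, `N ≥ 3`** — the printed leading tube: on the torus of
side `L + 1`, `L ≥ 3`, `L ≥ 2t`, `t ≥ 1`, in any dimension, `i < j`, `a ∉ {i, j}`, with `P` the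
periodised plaquette observable `Re tr U_p` at the origin in the `(i, j)` plane:
`torusTruncC ρ (L+1) P P (t·e_a) β − 2^{-(4t+1)} N^{-4t} β^{4t} = O(β^{4t+1})` at `β = 0`
[cite: MontvayMunster1994, §3.6.2 (3.437)]. [folklore] -/
theorem torusTruncC_leadingCoeff_sun (hN : 3 ≤ N) (hij : i < j) (hai : a ≠ i) (haj : a ≠ j)
    {t : ℕ} (ht : 1 ≤ t) (L : ℕ) (hL3 : 3 ≤ L) (hLt : 2 * t ≤ L) :
    (fun β : ℂ => torusTruncC (fundamentalRep (Fin N)) (L + 1)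
        (plaquetteObs (fundamentalRep (Fin N)) 0 i j) (plaquetteObs (fundamentalRep (Fin N)) 0 i j)
        (Pi.single a (t : ℤ)) β -
        ((((2 : ℝ) ^ (4 * t + 1))⁻¹ * ((N : ℝ) ^ (4 * t))⁻¹ : ℝ) : ℂ) * β ^ (4 * t))
      =O[𝓝 (0 : ℂ)] fun β => β ^ (4 * t + 1) := by
  haveI := secondCountableTopology_SU N
  have h := torusTruncC_leadingCoeff (oneLink_fundamentalRep_of_three_le hN) hij hai haj ht L hL3 hLt
  have hN0 : (N : ℝ) ≠ 0 := Nat.cast_ne_zero.2 (by omega)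
  have hb : (N : ℝ) * (1 / (2 * N)) ^ (4 * t + 1) = ((2 : ℝ) ^ (4 * t + 1))⁻¹ * ((N : ℝ) ^ (4 * t))⁻¹ := by
    rw [one_div, mul_inv, mul_pow, inv_pow, inv_pow, pow_succ (N : ℝ) (4 * t), mul_inv]
    field_simp
  rw [hb] at h
  exact h

/-- **(LC) AT EVERY SEPARATION FOR `SU(2)`**: the leading tube coefficient is `2^{-4t}`
(`θ = 1/2`, `N = 2`). [folklore] -/
theorem torusTruncC_leadingCoeff_su2 (hij : i < j) (hai : a ≠ i) (haj : a ≠ j)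
    {t : ℕ} (ht : 1 ≤ t) (L : ℕ) (hL3 : 3 ≤ L) (hLt : 2 * t ≤ L) :
    (fun β : ℂ => torusTruncC (fundamentalRep (Fin 2)) (L + 1)
        (plaquetteObs (fundamentalRep (Fin 2)) 0 i j) (plaquetteObs (fundamentalRep (Fin 2)) 0 i j)
        (Pi.single a (t : ℤ)) β -
        ((((2 : ℝ) ^ (4 * t))⁻¹ : ℝ) : ℂ) * β ^ (4 * t))
      =O[𝓝 (0 : ℂ)] fun β => β ^ (4 * t + 1) := by
  haveI := secondCountableTopology_SU 2
  have h := torusTruncC_leadingCoeff oneLink_fundamentalRep_two hij hai haj ht L hL3 hLt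
  have hb : ((2 : ℕ) : ℝ) * (1 / 2 : ℝ) ^ (4 * t + 1) = ((2 : ℝ) ^ (4 * t))⁻¹ := by
    rw [one_div, inv_pow, pow_succ]
    push_cast
    field_simp
  rw [hb] at h
  exact h

end Summit.Ventures.LatticeQCDFlow.Theory2.GroupLayer

end
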